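import Summits.SmoothPoincare4.SmoothPoincare4.Theorems.WeakReductionDescentDependentTripleGenusThreeStandardSectorOrientable
import Literature.Topology.FourManifolds.OneOneHandlebodyBoundary
import HarnessLib

/-!
# The boundary of a sector of a `(g; …, 1, …)`-trisection is `S² × S¹`

Helper file (`--supports stmt-SmoothPoincare4-18000`, registered helper
`helper_sectorBoundary_sphereTwo_prod_sphereOne` of the skeleton
`Cruxes/DependentTripleGenusThreeStandard/Lines/Sketch.lean`, setting of stub 3b: Aranda–Zupan's
Lemma 3.8 (arXiv:2503.04607, p. 10) is a statement about genus-`3` Heegaard splittings of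
`S¹ × S²`, applied to the splitting `∂X_2 = H_{20} ∪_F H_{12}` of the sector boundary of a
`(3; 1,1,1)`-trisection).

Clause (ii) of the tree's predicate `IsGKTrisection M g k T` (`Trisections.lean`) presents the
sector `T i` as the image of a topological embedding `e : W → M` of a compact connected smooth
`4`-manifold with boundary `W` with one `0`-handle and `k i` `1`-handles
(`HasHandleDecomposition 3 W (handleCount 1 (k i))`), a `C^∞` immersion off the central surface
with corner charts over it.  For `k i = 1`:

* `helper_sectorBoundary_sphereTwo_prod_sphereOne` (REGISTERED helper) — **every boundary datum
  `bW : BoundaryData (𝓡∂ 4) W (𝓡 3)` of `W` has carrier diffeomorphic to Mathlib's product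
  manifold `S² × S¹`**: `W` is Hausdorff and second countable (it embeds into `M`), orientable
  (`helper_isOrientable_sector_of_clause_ii`, the sibling file `…SectorOrientable.lean`: its
  interior immerses into the orientable `M`), and the boundary of a compact connected orientable
  `(1,1)`-handlebody is `S² × S¹` (the tree's PROVED
  `nonempty_diffeomorph_boundary_sphereTwo_prod_sphereOne_of_handleCount_one_one`,
  `OneOneHandlebodyBoundary.lean`; Kirby, *The topology of 4-manifolds* (1989), Ch. I §2, p. 8).

Everything is proved; no definitions, no named facts.

References: D. Gay, R. Kirby, *Trisecting 4-manifolds*, Geom. Topol. 20 (2016), Def. 1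
(`X_i ≅ ♮^{k_i}(S¹ × B³)`, `∂X_i ≅ #^{k_i}(S¹ × S²)`); R. Kirby, *The topology of 4-manifolds*,
LNM 1374 (1989), Ch. I §2, p. 8; R. Aranda, A. Zupan, arXiv:2503.04607 (2025), Lemma 3.8.
-/

-- the registered namespace `Summit.SmoothPoincare4.SmoothPoincare4.Theorems…` repeats a component
set_option linter.dupNamespace false

noncomputable section

open scoped Manifold ContDiff Topology
open Set Function
open Literature.Topology.FourManifolds

namespace Summit.SmoothPoincare4.SmoothPoincare4.Theorems

/-- **The boundary of a sector `X_i` with `k i = 1` of a Gay–Kirby trisection of an orientable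
`4`-manifold is diffeomorphic to `S² × S¹`.**  The hypotheses after
`IsGKTrisection M g k T → ∀ i, k i = 1 →` are verbatim the components of clause (ii) for the
sector `T i` (`obtain ⟨W, _, _, e, hM, hW, hc, hh, he, hrange, himm, hcorner, -⟩ := hT.2.1 i`):
`W` is Hausdorff and second countable through the embedding `e`
(`Topology.IsEmbedding.t2Space`, `Topology.IsEmbedding.secondCountableTopology`), orientable by
`helper_isOrientable_sector_of_clause_ii`, and a compact connected orientable `4`-dimensional
`(1,1)`-handlebody has boundary `S² × S¹`
(`nonempty_diffeomorph_boundary_sphereTwo_prod_sphereOne_of_handleCount_one_one`).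
Gay–Kirby, Def. 1: `∂X_i ≅ #^{k_i}(S¹ × S²)`, case `k_i = 1`.
[cite: GayKirby2016, Def. 1] [cite: Kirby1989, Ch. I §2, p. 8] -/
theorem helper_sectorBoundary_sphereTwo_prod_sphereOne :
    ∀ (M : Type) [TopologicalSpace M] [T2Space M] [SecondCountableTopology M]
      [ChartedSpace (EuclideanSpace ℝ (Fin 4)) M] [IsManifold (𝓡 4) ∞ M],
      IsOrientable (𝓡 4) M →
      ∀ (g : ℕ) (k : Fin 3 → ℕ) (T : Fin 3 → Set M), IsGKTrisection M g k T → ∀ (i : Fin 3), k i = 1 →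
      ∀ (W : Type) [TopologicalSpace W] [ChartedSpace (EuclideanHalfSpace 4) W] [IsManifold (𝓡∂ 4) ∞ W]
      (e : W → M), CompactSpace W → ConnectedSpace W →
      HasHandleDecomposition 3 W (handleCount 1 (k i)) →
      Topology.IsEmbedding e → range e = T i →
      (∀ w, e w ∉ (⋂ l, T l) → Manifold.IsImmersionAt (𝓡∂ 4) (𝓡 4) ∞ e w) →
      (∀ w, e w ∈ (⋂ l, T l) → IsCornerAt e w) →
      ∀ bW : BoundaryData (𝓡∂ 4) W (𝓡 3),
      Nonempty (bW.carrier ≃ₘ⟮𝓡 3, (𝓡 2).prod (𝓡 1)⟯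
        ((Metric.sphere (0 : EuclideanSpace ℝ (Fin 3)) 1) × (Metric.sphere (0 : EuclideanSpace ℝ (Fin 2)) 1))) := by
  intro M _ _ _ _ _ hM g k T hT i hki W _ _ _ e hW hc hh he hrange himm hcorner bW
  haveI : T2Space W := he.t2Space
  haveI : SecondCountableTopology W := he.secondCountableTopology
  haveI : CompactSpace W := hW
  haveI : ConnectedSpace W := hc
  have ho : IsOrientable (𝓡∂ 4) W :=
    helper_isOrientable_sector_of_clause_ii M hM g k T hT i W e hW hc hh he hrange himm hcorner
  have hh1 : HasHandleDecomposition 3 W (handleCount 1 1) := hki ▸ hh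
  exact nonempty_diffeomorph_boundary_sphereTwo_prod_sphereOne_of_handleCount_one_one W hh1 ho bW

end Summit.SmoothPoincare4.SmoothPoincare4.Theorems
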